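/-
Copyright (c) 2026. All rights reserved.
Released under Apache 2.0 license as described in the file LICENSE.
-/
import Literature.Probability.FitznerVanDerHofstad2017.NobleBoundsNMidStarZero
import Literature.Probability.FitznerVanDerHofstad2017.NobleBoundsNFirstSOpen
import HarnessLib

/-!
# NoBLE N-bounds — the first junction over a special successor junction (`a_1 = ★`)

The cells `(a_0, c, ★)`, `a_0, c ∈ {0, 1, 2}`, of the FIRST junction `k = 0`, variant `F‴` (the start piece below,
the CLOSED level `1` above: the successor junction `1` is special, `a 1 = ★`, either variant bit): closed twins of
the `(a_0, c, 0)` cells of `NobleBoundsNFirstS` / `NobleBoundsNFirstSNe` / `NobleBoundsNFirstSLow` /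
`NobleBoundsNFirstSOpen` §E and of the on-pin cell of `NobleBoundsNFirstF1`, written over the closed-level interface
`NobleBoundsNClosedU` (line table `b̄_0 → t_0`, `t_0 – z_0`, `t_0 → u_1`, `z_0 → u_1`; active upper slots `j < 4`;
canonical clause `t_0 = u_1 ↔ z_0 = u_1`) exactly as the middle-junction twins `NobleBoundsNMidStar`,
`NobleBoundsNMidStarZero` are written over `NobleBoundsNMidS*`.  Grouping `glFirstS3` (letters `P^{S,a_0}` =
{`lo 0, 1, 2`}, `A^{κ,a_0,c,*}` = {bond, `up 0`, `up 1`, `lo 3`}, `A^{c,0}` = {`up 2`, `up 3`}); the start letter is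
the grouping-free `first_startLetter_gl`.  Targets: off the pin
`P^{S,a_0}(u_0,w_0) · A^{κ,a_0,c,*}(u_0,w_0,t_0,z_0) · A^{c,0}(t_0,z_0,u_1,u_1)` (the `c`-summand of the first term of
(5.4) in the closed section, `w′ := u_1`), and on the pin (`c = 0`, `t_0 = z_0 = u_1`)
`P^{S,a_0}(u_0,w_0) · A'^{κ,a_0,0}(u_0,w_0,u_1,t_0)` (the second term of (5.4) at its internal vertex).
[cite: FitznerVanDerHofstad2017, §6.1 (6.4) and the Cases a, b ∈ {0, 1, ≥ 2} (arXiv:1506.07977v2 pp. 58–59); §5.1 (5.1)–(5.4) (pp. 46–48); (4.57), (4.58), (4.62), (4.65) (pp. 41, 43); App. B (pp. 73–75)]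
-/

namespace Literature.Probability.FitznerVanDerHofstad2017

open Literature.Barriers.CriticalPhenomena Literature.Probability.Percolation
open Literature.Probability.LatticeModels Literature.Combinatorics.SimpleGraph _root_.SimpleGraph
open _root_.MeasureTheory
open Literature.Probability.FitznerVanDerHofstad2017.NobleBlocks
open Literature.Probability.FitznerVanDerHofstad2017.NobleBlocks.LenIdx
open scoped ENNReal

variable {d : ℕ}

/-! ### A. The grouping over a closed level `1` -/

section Grouping

variable (M : ℕ) (x : Site d) (b : Fin (M + 2) → Site d × Site d) (w t z : Fin (M + 2) → Site d)
  (a : Fin (M + 2) → Fin 3 ⊕ Unit) (τ : Fin (M + 1) → Bool × Fin 3)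

/-- **The grouping `glFirstS3` obeys the (4.65) rule over a CLOSED level `1` as well**: its only cross-level letter
joins level-`0` lines with the entry slots `0, 1` of level `1`.
[cite: FitznerVanDerHofstad2017, §4.4 (4.65) and the sentence after it (arXiv:1506.07977v2 p. 43); (4.62) (p. 41)] -/
theorem glFirstS3_entry_closedU {u₀ : Unit} (ha' : a (0 : Fin (M + 1)).succ = Sum.inr u₀)
    (j j' : Fin 6) (hg : glFirstS3 (.lo j) = glFirstS3 (.up j')) :
    IsEntry (pieceViews M x b w t z a τ (0 : Fin (M + 1)).castSucc.succ).kd j' := by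
  rw [pieceViews_mid_kd, ha']
  show (j' : ℕ) < 2
  fin_cases j' <;> fin_cases j <;> simp [glFirstS3] at hg ⊢

end Grouping

/-! ### B. The parameter facts of the first junction over a closed level `1` -/

section FirstFacts

variable {M : ℕ} {x : Site d} {b : Fin (M + 2) → Site d × Site d} {w t z : Fin (M + 2) → Site d}
  {a : Fin (M + 2) → Fin 3 ⊕ Unit} {c : Fin 3 ⊕ Unit} {τ : Fin (M + 1) → Bool × Fin 3}
  {ω : Fin (M + 3) → BondConfig (Site d)} {K₀ : Fin (M + 3) → Fin 6 → Set (Sym2 (Site d))}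

variable (M x b w t z a c τ) in
/-- The PARAMETER FACTS of a non-empty first-junction piece over a closed level `1`, read off `JFacts`: the pin
clause `t_0 ≠ z_0 → z_0, t_0 ≠ u_1` (canonical clause of the closed level), `u_0 ∉ {t_0, z_0}` (vacancy), `b̄_0 ≠ z_0`
((4.64)), `u_0 = 0 → w_0 = 0`, the start class versus `w_0` and the sausage class versus `t_0, z_0`.
[cite: FitznerVanDerHofstad2017, (4.57), (4.58), (4.62), (4.64) and §6.1 "Case a, b" (arXiv:1506.07977v2 pp. 41–42, 58–59)] -/
theorem firstStar_facts (hF : JFacts M x b w t z a c τ ω K₀) {a₀ : Fin 3} {u₀ : Unit}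
    (ha : a (0 : Fin (M + 1)).castSucc = Sum.inl a₀) (ha' : a (0 : Fin (M + 1)).succ = Sum.inr u₀) :
    (t (0 : Fin (M + 1)).castSucc ≠ z (0 : Fin (M + 1)).castSucc →
        z (0 : Fin (M + 1)).castSucc ≠ (b (0 : Fin (M + 1)).succ).1 ∧
          t (0 : Fin (M + 1)).castSucc ≠ (b (0 : Fin (M + 1)).succ).1) ∧
      (b (0 : Fin (M + 1)).castSucc).1 ≠ t (0 : Fin (M + 1)).castSucc ∧
      (b (0 : Fin (M + 1)).castSucc).1 ≠ z (0 : Fin (M + 1)).castSucc ∧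
      (b (0 : Fin (M + 1)).castSucc).2 ≠ z (0 : Fin (M + 1)).castSucc ∧
      ((b (0 : Fin (M + 1)).castSucc).1 = 0 → w (0 : Fin (M + 1)).castSucc = 0) ∧
      (a₀ = 0 → w (0 : Fin (M + 1)).castSucc = (b (0 : Fin (M + 1)).castSucc).1) ∧
      (a₀ = 1 → (zdGraph d).Adj (b (0 : Fin (M + 1)).castSucc).1 (w (0 : Fin (M + 1)).castSucc)) ∧
      (a₀ = 2 → (b (0 : Fin (M + 1)).castSucc).1 ≠ w (0 : Fin (M + 1)).castSucc) ∧
      ((τ 0).2 = 0 → t (0 : Fin (M + 1)).castSucc = z (0 : Fin (M + 1)).castSucc) ∧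
      ((τ 0).2 ≠ 0 → t (0 : Fin (M + 1)).castSucc ≠ z (0 : Fin (M + 1)).castSucc) ∧
      ((τ 0).2 = 1 → (zdGraph d).Adj (t (0 : Fin (M + 1)).castSucc) (z (0 : Fin (M + 1)).castSucc) ∧
        s(t (0 : Fin (M + 1)).castSucc, z (0 : Fin (M + 1)).castSucc) ∈ ω (0 : Fin (M + 1)).castSucc.succ) ∧
      ((τ 0).2 = 2 →
        s(t (0 : Fin (M + 1)).castSucc, z (0 : Fin (M + 1)).castSucc) ∉ ω (0 : Fin (M + 1)).castSucc.succ) := by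
  have hv := hF.vac_closedU 0 ha'
  have hcan : (b (0 : Fin (M + 1)).castSucc).1 = 0 → w (0 : Fin (M + 1)).castSucc = 0 := (hF.level 0).1
  refine ⟨fun htz => hF.ne_pin_closedU 0 ha' htz, fun h => hv (by rw [h]; exact Set.mem_insert _ _),
    fun h => hv (by rw [h]; exact Set.mem_insert_of_mem _ (Set.mem_insert _ _)), hF.v_first_ne_z, hcan,
    ?_, ?_, ?_, ?_, ?_, ?_, ?_⟩
  · intro h0; exact hF.w_eq_of_exitClass_zero _ (ha.trans (by rw [h0]))
  · intro h1; exact (hF.exitClass_one _ (ha.trans (by rw [h1]))).2.2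
  · intro h2; exact hF.u_ne_w_of_exitClass_ne_zero _ ha (by rw [h2]; decide)
  · exact hF.t_eq_z_of_innerClass_zero 0
  · exact hF.t_ne_z_of_innerClass_ne_zero 0
  · intro h1; exact ⟨(hF.innerClass_one 0 h1).2.2, (hF.innerClass_one 0 h1).2.1⟩
  · intro h2; exact (hF.innerClass_two 0 h2).2

end FirstFacts

/-! ### C. Readings of the letters `xb` and `up 2` over a closed level `1` -/

section Letter

variable (p : unitInterval) (M : ℕ) (x : Site d) (b : Fin (M + 2) → Site d × Site d) (w t z : Fin (M + 2) → Site d)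
  (a : Fin (M + 2) → Fin 3 ⊕ Unit) (τ : Fin (M + 1) → Bool × Fin 3)

/-- **Four-line reading of the letter `xb`** under `glFirstS3` over a closed level `1`: bond (level `0`),
`b̄_0 → t_0`, `t_0 → z_0` (level `1`), the exit line of level `0` (slot `3`).
[cite: FitznerVanDerHofstad2017, §4.2 (4.18) (arXiv:1506.07977v2 p. 35); §6.1 (6.4) (p. 58); (4.62) (p. 41)] -/
theorem junF_firstStar_xb_le₄ {u₀ : Unit} (ha' : a (0 : Fin (M + 1)).succ = Sum.inr u₀)
    (EB X0 X1 X2 X3 E0 E1 E2 E3 E4 : Set (BondConfig (Site d))) :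
    junF p M x b w t z a τ (0 : Fin (M + 1)).castSucc glFirstS3 true false (firstEvS EB X0 X1 X2 X3 E0 E1 E2 E3 E4)
        .xb ≤
      piPerc d p 2 (genDisjOcc ![EB, E0, E1, X3] ![0, 1, 1, 0]) := by
  refine junF_le_of_lines p M x b w t z a τ (0 : Fin (M + 1)).castSucc glFirstS3 true false _ JIdx.xb
    ![JIdx.xb, .up 0, .up 1, .lo 3] (by decide) (fun m => ?_) ![0, 1, 1, 0] (fun m => by fin_cases m <;> rfl)
    ![EB, E0, E1, X3] (by funext m; fin_cases m <;> rfl)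
  fin_cases m
  · exact ⟨rfl, rfl⟩
  · exact ⟨(jClosedU_act_up_iff M x b w t z a τ 0 ha' true false 0).2 (by decide), rfl⟩
  · exact ⟨(jClosedU_act_up_iff M x b w t z a τ 0 ha' true false 1).2 (by decide), rfl⟩
  · exact ⟨(jFirst_act_lo_iff M x b w t z a τ true false 3).2 (by decide), rfl⟩

/-- **Three-line reading of the letter `xb`, sausage slot dropped** (`c = 0`: `t_0 = z_0`), closed level `1`.
[cite: FitznerVanDerHofstad2017, §4.2 (4.18) (arXiv:1506.07977v2 p. 35); §6.1 (6.4) (p. 58); (4.62) (p. 41)] -/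
theorem junF_firstStar_xb_le₃ {u₀ : Unit} (ha' : a (0 : Fin (M + 1)).succ = Sum.inr u₀)
    (EB X0 X1 X2 X3 E0 E1 E2 E3 E4 : Set (BondConfig (Site d))) :
    junF p M x b w t z a τ (0 : Fin (M + 1)).castSucc glFirstS3 true false (firstEvS EB X0 X1 X2 X3 E0 E1 E2 E3 E4)
        .xb ≤
      piPerc d p 2 (genDisjOcc ![EB, E0, X3] ![0, 1, 0]) := by
  refine junF_le_of_lines p M x b w t z a τ (0 : Fin (M + 1)).castSucc glFirstS3 true false _ JIdx.xb
    ![JIdx.xb, .up 0, .lo 3] (by decide) (fun m => ?_) ![0, 1, 0] (fun m => by fin_cases m <;> rfl)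
    ![EB, E0, X3] (by funext m; fin_cases m <;> rfl)
  fin_cases m
  · exact ⟨rfl, rfl⟩
  · exact ⟨(jClosedU_act_up_iff M x b w t z a τ 0 ha' true false 0).2 (by decide), rfl⟩
  · exact ⟨(jFirst_act_lo_iff M x b w t z a τ true false 3).2 (by decide), rfl⟩

/-- **Three-line reading of the letter `xb`, entry slot dropped** (sub-row `x = e` of row `(0,1)`: `t_0 = b̄_0`),
closed level `1`. [cite: FitznerVanDerHofstad2017, §4.2 (4.18) (arXiv:1506.07977v2 p. 35); §6.1 (6.4) (p. 58); (4.62) (p. 41)] -/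
theorem junF_firstStar_xb_le₃' {u₀ : Unit} (ha' : a (0 : Fin (M + 1)).succ = Sum.inr u₀)
    (EB X0 X1 X2 X3 E0 E1 E2 E3 E4 : Set (BondConfig (Site d))) :
    junF p M x b w t z a τ (0 : Fin (M + 1)).castSucc glFirstS3 true false (firstEvS EB X0 X1 X2 X3 E0 E1 E2 E3 E4)
        .xb ≤
      piPerc d p 2 (genDisjOcc ![EB, E1, X3] ![0, 1, 0]) := by
  refine junF_le_of_lines p M x b w t z a τ (0 : Fin (M + 1)).castSucc glFirstS3 true false _ JIdx.xb
    ![JIdx.xb, .up 1, .lo 3] (by decide) (fun m => ?_) ![0, 1, 0] (fun m => by fin_cases m <;> rfl)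
    ![EB, E1, X3] (by funext m; fin_cases m <;> rfl)
  fin_cases m
  · exact ⟨rfl, rfl⟩
  · exact ⟨(jClosedU_act_up_iff M x b w t z a τ 0 ha' true false 1).2 (by decide), rfl⟩
  · exact ⟨(jFirst_act_lo_iff M x b w t z a τ true false 3).2 (by decide), rfl⟩

/-- **Two-line reading of the letter `up 2`** under `glFirstS3` over a closed level `1`: `t_0 → u_1` (slot `2`),
`u_1 → z_0` (slot `3`, read backwards). [cite: FitznerVanDerHofstad2017, §4.2 (4.16) (arXiv:1506.07977v2 p. 36); §6.1 (6.4) (p. 58); (4.62) (p. 41)] -/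
theorem junF_firstStar_up_le₂ {u₀ : Unit} (ha' : a (0 : Fin (M + 1)).succ = Sum.inr u₀)
    (EB X0 X1 X2 X3 E0 E1 E2 E3 E4 : Set (BondConfig (Site d))) :
    junF p M x b w t z a τ (0 : Fin (M + 1)).castSucc glFirstS3 true false (firstEvS EB X0 X1 X2 X3 E0 E1 E2 E3 E4)
        (.up 2) ≤
      piPerc d p 2 (genDisjOcc ![E2, E3] ![1, 1]) := by
  refine junF_le_of_lines p M x b w t z a τ (0 : Fin (M + 1)).castSucc glFirstS3 true false _ (JIdx.up 2)
    ![JIdx.up 2, .up 3] (by decide) (fun m => ?_) ![1, 1] (fun m => by fin_cases m <;> rfl)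
    ![E2, E3] (by funext m; fin_cases m <;> rfl)
  fin_cases m
  · exact ⟨(jClosedU_act_up_iff M x b w t z a τ 0 ha' true false 2).2 (by decide), rfl⟩
  · exact ⟨(jClosedU_act_up_iff M x b w t z a τ 0 ha' true false 3).2 (by decide), rfl⟩

variable (c : Fin 3 ⊕ Unit)

/-- **The core of the first-junction ★-packages** (grouping `glFirstS3`, closed level `1`): start-letter data
(`X0, X1, X2`), finitary events `X3 ⊇` the exit witness of level `0`, `E0, …, E3 ⊇` the witnesses of the four lines of
the closed level `1`, and bounds of the three letters `lo 0 ≤ T₀`, `xb ≤ T₁`, `up 2 ≤ T₂` give a package with target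
`T₀ * (T₁ * T₂)`. [cite: FitznerVanDerHofstad2017, §6.1 (6.4) (arXiv:1506.07977v2 p. 58); §4.4 (4.57), (4.58), (4.62), (4.65) (pp. 41, 43)] -/
theorem nonempty_jPkg_firstStar_core (κ : Fin d × Bool)
    (hb : (b (0 : Fin (M + 1)).castSucc).2 = (b (0 : Fin (M + 1)).castSucc).1 + stepVec κ) {u₀ : Unit}
    (ha' : a (0 : Fin (M + 1)).succ = Sum.inr u₀) (X0 X1 X2 X3 E0 E1 E2 E3 : Set (BondConfig (Site d)))
    (f0 : IsFinitary X0) (f1 : IsFinitary X1) (f2 : IsFinitary X2) (f3 : IsFinitary X3) (h0 : IsFinitary E0)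
    (h1 : IsFinitary E1) (h2 : IsFinitary E2) (h3 : IsFinitary E3)
    (hmem : ∀ ω K₀, JFacts M x b w t z a c τ ω K₀ →
      K₀ (0 : Fin (M + 1)).castSucc.castSucc 0 ∈ X0 ∧ K₀ (0 : Fin (M + 1)).castSucc.castSucc 1 ∈ X1 ∧
        K₀ (0 : Fin (M + 1)).castSucc.castSucc 2 ∈ X2 ∧ K₀ (0 : Fin (M + 1)).castSucc.castSucc 3 ∈ X3 ∧
        K₀ (0 : Fin (M + 1)).castSucc.succ 0 ∈ E0 ∧ K₀ (0 : Fin (M + 1)).castSucc.succ 1 ∈ E1 ∧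
        K₀ (0 : Fin (M + 1)).castSucc.succ 2 ∈ E2 ∧ K₀ (0 : Fin (M + 1)).castSucc.succ 3 ∈ E3)
    {T₀ T₁ T₂ : ℝ≥0∞}
    (hrow₀ : junF p M x b w t z a τ (0 : Fin (M + 1)).castSucc glFirstS3 true false
      (firstEvS (event (eq 1) (b (0 : Fin (M + 1)).castSucc).1 (b (0 : Fin (M + 1)).castSucc).2)
        X0 X1 X2 X3 E0 E1 E2 E3 Set.univ) (.lo 0) ≤ T₀)
    (hrow₁ : junF p M x b w t z a τ (0 : Fin (M + 1)).castSucc glFirstS3 true false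
      (firstEvS (event (eq 1) (b (0 : Fin (M + 1)).castSucc).1 (b (0 : Fin (M + 1)).castSucc).2)
        X0 X1 X2 X3 E0 E1 E2 E3 Set.univ) .xb ≤ T₁)
    (hrow₂ : junF p M x b w t z a τ (0 : Fin (M + 1)).castSucc glFirstS3 true false
      (firstEvS (event (eq 1) (b (0 : Fin (M + 1)).castSucc).1 (b (0 : Fin (M + 1)).castSucc).2)
        X0 X1 X2 X3 E0 E1 E2 E3 Set.univ) (.up 2) ≤ T₂) :
    Nonempty (JPkg p (jctx M x b w t z a τ (0 : Fin (M + 1)).castSucc) (JFacts M x b w t z a c τ)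
      (T₀ * (T₁ * T₂))) := by
  have huv : (b (0 : Fin (M + 1)).castSucc).1 ≠ (b (0 : Fin (M + 1)).castSucc).2 := by
    rw [hb]; exact (zdGraph_adj_iff_stepVec _ _ |>.2 ⟨κ, rfl⟩).ne
  rw [← mul_assoc]
  refine nonempty_jPkg_of_joint p (0 : Fin (M + 1)).castSucc glFirstS3 true
    (firstEvS (event (eq 1) (b (0 : Fin (M + 1)).castSucc).1 (b (0 : Fin (M + 1)).castSucc).2)
      X0 X1 X2 X3 E0 E1 E2 E3 Set.univ)
    (isFinitary_firstEvS _ _ _ _ _ _ _ _ _ _ (isFinitary_event _ _ _) f0 f1 f2 f3 h0 h1 h2 h3 isFinitary_univ)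
    (fun _ => by rw [firstEvS_xb]; exact singleton_mem_event_eq_one huv)
    (fun j j' _ _ hg => glFirstS3_entry_closedU M x b w t z a τ ha' j j' hg)
    (fun ω K₀ hF => ⟨fun j hj => ?_, fun j hj => ?_⟩) ?_
  · -- the witnesses of the start level
    have hj4 : (j : ℕ) < 4 := (jFirst_act_lo_iff M x b w t z a τ true false j).1 hj
    obtain ⟨m0, m1, m2, m3, -⟩ := hmem ω K₀ hF
    exact mem_firstEvS_lo _ _ _ _ _ _ _ _ _ _ m0 m1 m2 m3 j hj4
  · -- the witnesses of the closed level `1` (slots `0`–`3` only)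
    have hj4 : (j : ℕ) < 4 := (jClosedU_act_up_iff M x b w t z a τ 0 ha' true false j).1 hj
    have hj5 : j ≠ 5 := by intro h; rw [h] at hj4; exact absurd hj4 (by decide)
    obtain ⟨-, -, -, -, m0, m1, m2, m3⟩ := hmem ω K₀ hF
    exact mem_firstEvS_up _ _ _ _ _ _ _ _ _ _ m0 m1 m2 m3 (Set.mem_univ _) j hj5
  · -- three genuine letters
    exact (prod_junF_le₃ p M x b w t z a τ (0 : Fin (M + 1)).castSucc glFirstS3 true false _
      (show JIdx.lo 0 ≠ JIdx.xb by decide) (show JIdx.lo 0 ≠ JIdx.up 2 by decide)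
      (show JIdx.xb ≠ JIdx.up 2 by decide)).trans (mul_le_mul' (mul_le_mul' hrow₀ hrow₁) hrow₂)

/-- **The core of the first-junction term-2 package over a closed level `1`** (on the pin `t_0 = z_0 = u_1`):
start-letter data, finitary events `X3 ⊇` the exit witness of level `0` and `E0 ⊇` the witness of `b̄_0 → t_0`, and
bounds of the two genuine letters `lo 0 ≤ T₀`, `xb ≤ T₁` give a package with target `T₀ * T₁`; the letter `up 2`
(the loops `t_0 → u_1`, `z_0 → u_1`) is bounded by `1`.
[cite: FitznerVanDerHofstad2017, §6.1 (6.4) (arXiv:1506.07977v2 p. 58); §5.1 (5.4) second term (p. 48); §4.4 (4.57), (4.58), (4.62), (4.65) (pp. 41, 43)] -/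
theorem nonempty_jPkg_firstStar_core₂ (κ : Fin d × Bool)
    (hb : (b (0 : Fin (M + 1)).castSucc).2 = (b (0 : Fin (M + 1)).castSucc).1 + stepVec κ) {u₀ : Unit}
    (ha' : a (0 : Fin (M + 1)).succ = Sum.inr u₀) (X0 X1 X2 X3 E0 : Set (BondConfig (Site d)))
    (f0 : IsFinitary X0) (f1 : IsFinitary X1) (f2 : IsFinitary X2) (f3 : IsFinitary X3) (h0 : IsFinitary E0)
    (hmem : ∀ ω K₀, JFacts M x b w t z a c τ ω K₀ →
      K₀ (0 : Fin (M + 1)).castSucc.castSucc 0 ∈ X0 ∧ K₀ (0 : Fin (M + 1)).castSucc.castSucc 1 ∈ X1 ∧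
        K₀ (0 : Fin (M + 1)).castSucc.castSucc 2 ∈ X2 ∧ K₀ (0 : Fin (M + 1)).castSucc.castSucc 3 ∈ X3 ∧
        K₀ (0 : Fin (M + 1)).castSucc.succ 0 ∈ E0)
    {T₀ T₁ : ℝ≥0∞}
    (hrow₀ : junF p M x b w t z a τ (0 : Fin (M + 1)).castSucc glFirstS3 true false
      (firstEvS (event (eq 1) (b (0 : Fin (M + 1)).castSucc).1 (b (0 : Fin (M + 1)).castSucc).2)
        X0 X1 X2 X3 E0 Set.univ Set.univ Set.univ Set.univ) (.lo 0) ≤ T₀)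
    (hrow₁ : junF p M x b w t z a τ (0 : Fin (M + 1)).castSucc glFirstS3 true false
      (firstEvS (event (eq 1) (b (0 : Fin (M + 1)).castSucc).1 (b (0 : Fin (M + 1)).castSucc).2)
        X0 X1 X2 X3 E0 Set.univ Set.univ Set.univ Set.univ) .xb ≤ T₁) :
    Nonempty (JPkg p (jctx M x b w t z a τ (0 : Fin (M + 1)).castSucc) (JFacts M x b w t z a c τ) (T₀ * T₁)) := by
  have huv : (b (0 : Fin (M + 1)).castSucc).1 ≠ (b (0 : Fin (M + 1)).castSucc).2 := by
    rw [hb]; exact (zdGraph_adj_iff_stepVec _ _ |>.2 ⟨κ, rfl⟩).ne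
  refine nonempty_jPkg_of_joint p (0 : Fin (M + 1)).castSucc glFirstS3 true
    (firstEvS (event (eq 1) (b (0 : Fin (M + 1)).castSucc).1 (b (0 : Fin (M + 1)).castSucc).2)
      X0 X1 X2 X3 E0 Set.univ Set.univ Set.univ Set.univ)
    (isFinitary_firstEvS _ _ _ _ _ _ _ _ _ _ (isFinitary_event _ _ _) f0 f1 f2 f3 h0 isFinitary_univ
      isFinitary_univ isFinitary_univ isFinitary_univ)
    (fun _ => by rw [firstEvS_xb]; exact singleton_mem_event_eq_one huv)
    (fun j j' _ _ hg => glFirstS3_entry_closedU M x b w t z a τ ha' j j' hg)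
    (fun ω K₀ hF => ⟨fun j hj => ?_, fun j hj => ?_⟩) ?_
  · -- the witnesses of the start level
    have hj4 : (j : ℕ) < 4 := (jFirst_act_lo_iff M x b w t z a τ true false j).1 hj
    obtain ⟨m0, m1, m2, m3, -⟩ := hmem ω K₀ hF
    exact mem_firstEvS_lo _ _ _ _ _ _ _ _ _ _ m0 m1 m2 m3 j hj4
  · -- the witnesses of the closed level `1` (slots `0`–`3` only)
    have hj4 : (j : ℕ) < 4 := (jClosedU_act_up_iff M x b w t z a τ 0 ha' true false j).1 hj
    have hj5 : j ≠ 5 := by intro h; rw [h] at hj4; exact absurd hj4 (by decide)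
    obtain ⟨-, -, -, -, m0⟩ := hmem ω K₀ hF
    exact mem_firstEvS_up _ _ _ _ _ _ _ _ _ _ m0 (Set.mem_univ _) (Set.mem_univ _) (Set.mem_univ _)
      (Set.mem_univ _) j hj5
  · -- two genuine letters
    exact (prod_junF_le₂ p M x b w t z a τ (0 : Fin (M + 1)).castSucc glFirstS3 true false _
      (show JIdx.lo 0 ≠ JIdx.xb by decide)).trans (mul_le_mul' hrow₀ hrow₁)

end Letter

/-! ### D. The cells `(a_0, c, ★)` of the first junction -/

section Packages

variable (p : unitInterval) (M : ℕ) (x : Site d) (b : Fin (M + 2) → Site d × Site d) (w t z : Fin (M + 2) → Site d)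
  (a : Fin (M + 2) → Fin 3 ⊕ Unit) (c : Fin 3 ⊕ Unit) (τ : Fin (M + 1) → Bool × Fin 3)

/-- **Cells `(a_0, 2, ★)`, `a_0 ∈ {0,1,2}`, variant `F‴`, of the FIRST junction** (successor junction `1` special):
a package with target `P^{S,a_0}(u_0,w_0) · (A^{κ,a_0,2,*}(u_0,w_0,t_0,z_0) · A^{2,0}(t_0,z_0,u_1,u_1))` — the `c = 2`
summand of the `k = 0` factor of the pointwise (6.4) in the closed section.  Inner class `2` upgrades the sausage
line to `{t_0 ←2→ z_0}`; the closed level's canonical clause with `t_0 ≠ z_0` gives `t_0 ≠ u_1`, so the exit letter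
reads `{t_0 ←1→ u_1} ⊛ {u_1 ↔ z_0} ≤ A^{2,0}`; start and `A^{κ,a_0,2,*}` letters exactly as in the open cells
`NobleBoundsNFirstSOpen.nonempty_jPkg_firstS_two_open`.
[cite: FitznerVanDerHofstad2017, §6.1 (6.4), "Case a = 0 / 1 / ≥ 2", "Case b ≥ 2" (arXiv:1506.07977v2 pp. 58–59); §5.1 (5.1)–(5.4) (pp. 46–48); (4.58), (4.62) (p. 41); App. B (pp. 73–75)] -/
theorem nonempty_jPkg_firstStar_two (κ : Fin d × Bool)
    (hb : (b (0 : Fin (M + 1)).castSucc).2 = (b (0 : Fin (M + 1)).castSucc).1 + stepVec κ) (hc2 : (τ 0).2 = 2)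
    (a₀ : Fin 3) (ha : a (0 : Fin (M + 1)).castSucc = Sum.inl a₀) {u₀ : Unit}
    (ha' : a (0 : Fin (M + 1)).succ = Sum.inr u₀) :
    Nonempty (JPkg p (jctx M x b w t z a τ (0 : Fin (M + 1)).castSucc) (JFacts M x b w t z a c τ)
      (blockPS (Letters.perc d p) a₀ (b (0 : Fin (M + 1)).castSucc).1 (w (0 : Fin (M + 1)).castSucc) *
        (blockAiotaSt (Letters.perc d p) κ a₀ 2 (b (0 : Fin (M + 1)).castSucc).1 (w (0 : Fin (M + 1)).castSucc)
            (t (0 : Fin (M + 1)).castSucc) (z (0 : Fin (M + 1)).castSucc) *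
          blockA (Letters.perc d p) 2 0 (t (0 : Fin (M + 1)).castSucc) (z (0 : Fin (M + 1)).castSucc)
            (b (0 : Fin (M + 1)).succ).1 (b (0 : Fin (M + 1)).succ).1))) := by
  -- degenerate parameters: the piece is empty
  by_cases hP : t (0 : Fin (M + 1)).castSucc ≠ z (0 : Fin (M + 1)).castSucc ∧
      t (0 : Fin (M + 1)).castSucc ≠ (b (0 : Fin (M + 1)).succ).1 ∧
      (b (0 : Fin (M + 1)).castSucc).1 ≠ t (0 : Fin (M + 1)).castSucc ∧
      (b (0 : Fin (M + 1)).castSucc).1 ≠ z (0 : Fin (M + 1)).castSucc ∧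
      (b (0 : Fin (M + 1)).castSucc).2 ≠ z (0 : Fin (M + 1)).castSucc ∧
      ((b (0 : Fin (M + 1)).castSucc).1 = 0 → w (0 : Fin (M + 1)).castSucc = 0) ∧
      (a₀ = 0 → w (0 : Fin (M + 1)).castSucc = (b (0 : Fin (M + 1)).castSucc).1) ∧
      (a₀ = 1 → (zdGraph d).Adj (b (0 : Fin (M + 1)).castSucc).1 (w (0 : Fin (M + 1)).castSucc)) ∧
      (a₀ = 2 → (b (0 : Fin (M + 1)).castSucc).1 ≠ w (0 : Fin (M + 1)).castSucc)
  swap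
  · refine ⟨JPkg.vacuous p _ _ (fun ω K₀ hF => hP ?_) _⟩
    obtain ⟨hpin, hut, huz, hvz, hcan, hw0, hw1, hw2, -, hcn, -, -⟩ := firstStar_facts M x b w t z a c τ hF ha ha'
    have htz := hcn (by rw [hc2]; decide)
    exact ⟨htz, (hpin htz).2, hut, huz, hvz, hcan, hw0, hw1, hw2⟩
  obtain ⟨htz, hty, hut, huz, hvz, hcan, hw0, hw1, hw2⟩ := hP
  obtain ⟨X0, X1, X2, f0, f1, f2, hmem₀, hrow₀⟩ :=
    first_startLetter_gl p M x b w t z a c τ glFirstS3 true false (.lo 0) rfl rfl rfl ha hcan hw0 hw1 hw2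
  refine nonempty_jPkg_firstStar_core p M x b w t z a τ c κ hb ha' X0 X1 X2
    (endX a₀ (b (0 : Fin (M + 1)).castSucc).1 (w (0 : Fin (M + 1)).castSucc) (z (0 : Fin (M + 1)).castSucc))
    (event (ge 0) (b (0 : Fin (M + 1)).castSucc).2 (t (0 : Fin (M + 1)).castSucc))
    (event (ge 2) (t (0 : Fin (M + 1)).castSucc) (z (0 : Fin (M + 1)).castSucc))
    (event (ge 1) (t (0 : Fin (M + 1)).castSucc) (b (0 : Fin (M + 1)).succ).1)
    (event (ge 0) (b (0 : Fin (M + 1)).succ).1 (z (0 : Fin (M + 1)).castSucc)) f0 f1 f2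
    (isFinitary_endX _ _ _ _) (isFinitary_event _ _ _) (isFinitary_event _ _ _) (isFinitary_event _ _ _)
    (isFinitary_event _ _ _)
    (fun ω K₀ hF => ⟨(hmem₀ ω K₀ hF).1, (hmem₀ ω K₀ hF).2.1, (hmem₀ ω K₀ hF).2.2,
      firstSOpen_exit_mem M x b w t z a c τ hF huz hw0, ?_, ?_, ?_, ?_⟩)
    (hrow₀ _ rfl rfl rfl) ?_ ?_
  · obtain ⟨h0, -⟩ := hF.conn_closedU 0 ha'
    rw [event_ge]; exact mem_openConnGe_zero_of_mem h0
  · obtain ⟨-, h1, -⟩ := hF.conn_closedU 0 ha'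
    obtain ⟨-, -, -, -, -, -, -, -, -, -, -, hc2'⟩ := firstStar_facts M x b w t z a c τ hF ha ha'
    rw [event_ge]
    exact mem_openConnGe_two_of_notMem h1 htz fun hm => hc2' hc2 (hF.witness_subset _ 1 hm)
  · obtain ⟨-, -, h2, -⟩ := hF.conn_closedU 0 ha'
    rw [event_ge]; exact mem_openConnGe_one_of_ne h2 hty
  · obtain ⟨-, -, -, h3⟩ := hF.conn_closedU 0 ha'
    rw [event_comm, event_ge]; exact mem_openConnGe_zero_of_mem h3
  · -- `A^{κ,a_0,2,*}`: bond, `b̄_0 → t_0`, `t_0 ⇔ z_0` of level `1`, exit of level `0`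
    refine (junF_firstStar_xb_le₄ p M x b w t z a τ ha' _ _ _ _ _ _ _ _ _ _).trans ?_
    unfold endX
    split_ifs with h0
    · subst h0
      rw [hw0 rfl]
      exact piPerc_midS_zero_two_le_blockAiotaSt p hb (fun h => hut h.symm) (fun h => huz h.symm) _
    · obtain h1 | h2 : a₀ = 1 ∨ a₀ = 2 := by
        fin_cases a₀
        · exact absurd rfl h0
        · exact Or.inl rfl
        · exact Or.inr rfl
      · subst h1
        obtain ⟨κ', hκ'⟩ := (zdGraph_adj_iff_stepVec _ _).1 (hw1 rfl)
        exact piPerc_midS_one_two_le_blockAiotaSt p hb hκ' _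
      · subst h2
        exact piPerc_midS_two_two_le_blockAiotaSt p hb _
  · -- `A^{2,0}`: `t_0 → u_1`, `u_1 → z_0` on the closed level `1`
    refine (junF_firstStar_up_le₂ p M x b w t z a τ ha' _ _ _ _ _ _ _ _ _ _).trans ?_
    exact piPerc_midS_two_zero_le_blockA p _

/-- **Cells `(a_0, 1, ★)`, `a_0 ∈ {0,1,2}`, variant `F‴`, of the FIRST junction**: a package with target
`P^{S,a_0}(u_0,w_0) · (A^{κ,a_0,1,*}(u_0,w_0,t_0,z_0) · A^{1,0}(t_0,z_0,u_1,u_1))`.  The sausage line of level `1` is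
the open bond `{t_0 ←1̲→ z_0}` itself (`Conds.tzNF`); the closed level's canonical clause gives `t_0, z_0 ≠ u_1`, so
the exit letter reads `{t_0 ←1→ u_1} ⊛ {u_1 ←1→ z_0} ≤ 2dD(z_0−t_0) 𝓑_{1,1}(u_1−t_0, z_0−t_0) = A^{1,0}`; row `a_0 = 0`
splits into `t_0 = b̄_0` (triangle, exit line of level `0` of length `≥ 2` by parity) and `t_0 ≠ b̄_0` (square), as in
`NobleBoundsNFirstSOpen.nonempty_jPkg_firstS_one_open`.
[cite: FitznerVanDerHofstad2017, §6.1 (6.4), "Case a = 0 / 1 / ≥ 2", "Case b = 1" (arXiv:1506.07977v2 pp. 58–59); §5.1 (5.1)–(5.4) (pp. 46–48); (4.58), (4.62) (p. 41); App. B (pp. 73–75)] -/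
theorem nonempty_jPkg_firstStar_one (κ : Fin d × Bool)
    (hb : (b (0 : Fin (M + 1)).castSucc).2 = (b (0 : Fin (M + 1)).castSucc).1 + stepVec κ) (hc1 : (τ 0).2 = 1)
    (a₀ : Fin 3) (ha : a (0 : Fin (M + 1)).castSucc = Sum.inl a₀) {u₀ : Unit}
    (ha' : a (0 : Fin (M + 1)).succ = Sum.inr u₀) :
    Nonempty (JPkg p (jctx M x b w t z a τ (0 : Fin (M + 1)).castSucc) (JFacts M x b w t z a c τ)
      (blockPS (Letters.perc d p) a₀ (b (0 : Fin (M + 1)).castSucc).1 (w (0 : Fin (M + 1)).castSucc) *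
        (blockAiotaSt (Letters.perc d p) κ a₀ 1 (b (0 : Fin (M + 1)).castSucc).1 (w (0 : Fin (M + 1)).castSucc)
            (t (0 : Fin (M + 1)).castSucc) (z (0 : Fin (M + 1)).castSucc) *
          blockA (Letters.perc d p) 1 0 (t (0 : Fin (M + 1)).castSucc) (z (0 : Fin (M + 1)).castSucc)
            (b (0 : Fin (M + 1)).succ).1 (b (0 : Fin (M + 1)).succ).1))) := by
  -- degenerate parameters: the piece is empty
  by_cases hP : (zdGraph d).Adj (t (0 : Fin (M + 1)).castSucc) (z (0 : Fin (M + 1)).castSucc) ∧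
      t (0 : Fin (M + 1)).castSucc ≠ (b (0 : Fin (M + 1)).succ).1 ∧
      z (0 : Fin (M + 1)).castSucc ≠ (b (0 : Fin (M + 1)).succ).1 ∧
      (b (0 : Fin (M + 1)).castSucc).1 ≠ t (0 : Fin (M + 1)).castSucc ∧
      (b (0 : Fin (M + 1)).castSucc).1 ≠ z (0 : Fin (M + 1)).castSucc ∧
      (b (0 : Fin (M + 1)).castSucc).2 ≠ z (0 : Fin (M + 1)).castSucc ∧
      ((b (0 : Fin (M + 1)).castSucc).1 = 0 → w (0 : Fin (M + 1)).castSucc = 0) ∧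
      (a₀ = 0 → w (0 : Fin (M + 1)).castSucc = (b (0 : Fin (M + 1)).castSucc).1) ∧
      (a₀ = 1 → (zdGraph d).Adj (b (0 : Fin (M + 1)).castSucc).1 (w (0 : Fin (M + 1)).castSucc)) ∧
      (a₀ = 2 → (b (0 : Fin (M + 1)).castSucc).1 ≠ w (0 : Fin (M + 1)).castSucc)
  swap
  · refine ⟨JPkg.vacuous p _ _ (fun ω K₀ hF => hP ?_) _⟩
    obtain ⟨hpin, hut, huz, hvz, hcan, hw0, hw1, hw2, -, -, hc1', -⟩ := firstStar_facts M x b w t z a c τ hF ha ha'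
    have hadj := (hc1' hc1).1
    exact ⟨hadj, (hpin hadj.ne).2, (hpin hadj.ne).1, hut, huz, hvz, hcan, hw0, hw1, hw2⟩
  obtain ⟨hadj, hty, hzy, hut, huz, hvz, hcan, hw0, hw1, hw2⟩ := hP
  have htz : t (0 : Fin (M + 1)).castSucc ≠ z (0 : Fin (M + 1)).castSucc := hadj.ne
  obtain ⟨κ', hκ'⟩ := (zdGraph_adj_iff_stepVec _ _).1 hadj
  obtain ⟨X0, X1, X2, f0, f1, f2, hmem₀, hrow₀⟩ :=
    first_startLetter_gl p M x b w t z a c τ glFirstS3 true false (.lo 0) rfl rfl rfl ha hcan hw0 hw1 hw2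
  -- the open sausage bond is its own witness
  have hbond : ∀ ω K₀, JFacts M x b w t z a c τ ω K₀ →
      K₀ (0 : Fin (M + 1)).castSucc.succ 1 ∈
        (event (eq 1) (t (0 : Fin (M + 1)).castSucc) (z (0 : Fin (M + 1)).castSucc) : Set (BondConfig (Site d))) := by
    intro ω K₀ hF
    obtain ⟨-, -, -, -, -, -, -, -, -, -, hc1', -⟩ := firstStar_facts M x b w t z a c τ hF ha ha'
    rw [hF.tz_witness_closedU 0 ha' htz (hc1' hc1).2]
    exact singleton_mem_event_eq_one htz
  -- the exit letter `A^{1,0}`: `t_0 → u_1`, `u_1 → z_0` on the closed level `1`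
  have hexit : ∀ ω K₀, JFacts M x b w t z a c τ ω K₀ →
      K₀ (0 : Fin (M + 1)).castSucc.succ 2 ∈
          (event (ge 1) (t (0 : Fin (M + 1)).castSucc) (b (0 : Fin (M + 1)).succ).1 : Set (BondConfig (Site d))) ∧
        K₀ (0 : Fin (M + 1)).castSucc.succ 3 ∈
          (event (ge 1) (b (0 : Fin (M + 1)).succ).1 (z (0 : Fin (M + 1)).castSucc) : Set (BondConfig (Site d))) := by
    intro ω K₀ hF
    obtain ⟨-, -, h2, h3⟩ := hF.conn_closedU 0 ha'
    refine ⟨?_, ?_⟩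
    · rw [event_ge]; exact mem_openConnGe_one_of_ne h2 hty
    · rw [event_comm, event_ge]; exact mem_openConnGe_one_of_ne h3 hzy
  have hrow₂ : ∀ EB X0 X1 X2 X3 E0 E1 E4 : Set (BondConfig (Site d)),
      junF p M x b w t z a τ (0 : Fin (M + 1)).castSucc glFirstS3 true false
          (firstEvS EB X0 X1 X2 X3 E0 E1
            (event (ge 1) (t (0 : Fin (M + 1)).castSucc) (b (0 : Fin (M + 1)).succ).1)
            (event (ge 1) (b (0 : Fin (M + 1)).succ).1 (z (0 : Fin (M + 1)).castSucc)) E4) (.up 2) ≤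
        blockA (Letters.perc d p) 1 0 (t (0 : Fin (M + 1)).castSucc) (z (0 : Fin (M + 1)).castSucc)
          (b (0 : Fin (M + 1)).succ).1 (b (0 : Fin (M + 1)).succ).1 := fun EB X0 X1 X2 X3 E0 E1 E4 =>
    (junF_firstStar_up_le₂ p M x b w t z a τ ha' _ _ _ _ _ _ _ _ _ _).trans (piPerc_midS_one_zero_le_blockA p hκ' _)
  by_cases h0 : a₀ = 0
  · subst h0
    have hwu : w (0 : Fin (M + 1)).castSucc = (b (0 : Fin (M + 1)).castSucc).1 := hw0 rfl
    by_cases hx : t (0 : Fin (M + 1)).castSucc = (b (0 : Fin (M + 1)).castSucc).2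
    · -- sub-row `x = e`: triangle, exit line of length `≥ 2` by parity
      refine nonempty_jPkg_firstStar_core p M x b w t z a τ c κ hb ha' X0 X1 X2
        (event (ge 2) (z (0 : Fin (M + 1)).castSucc) (b (0 : Fin (M + 1)).castSucc).1) Set.univ
        (event (eq 1) (t (0 : Fin (M + 1)).castSucc) (z (0 : Fin (M + 1)).castSucc))
        (event (ge 1) (t (0 : Fin (M + 1)).castSucc) (b (0 : Fin (M + 1)).succ).1)
        (event (ge 1) (b (0 : Fin (M + 1)).succ).1 (z (0 : Fin (M + 1)).castSucc)) f0 f1 f2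
        (isFinitary_event _ _ _) isFinitary_univ (isFinitary_event _ _ _) (isFinitary_event _ _ _)
        (isFinitary_event _ _ _)
        (fun ω K₀ hF => ⟨(hmem₀ ω K₀ hF).1, (hmem₀ ω K₀ hF).2.1, (hmem₀ ω K₀ hF).2.2, ?_, Set.mem_univ _,
          hbond ω K₀ hF, (hexit ω K₀ hF).1, (hexit ω K₀ hF).2⟩)
        (hrow₀ _ rfl rfl rfl) ?_ (hrow₂ _ _ _ _ _ _ _ _)
      · obtain ⟨-, -, h3⟩ := hF.conn_first
        rw [hwu] at h3
        have hadj' : (zdGraph d).Adj (b (0 : Fin (M + 1)).castSucc).1 (b (0 : Fin (M + 1)).castSucc).2 :=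
          (zdGraph_adj_iff_stepVec _ _).2 ⟨κ, hb⟩
        have hna : ¬ (zdGraph d).Adj (b (0 : Fin (M + 1)).castSucc).1 (z (0 : Fin (M + 1)).castSucc) :=
          not_adj_of_adj_adj hadj' (by rw [← hx]; exact hadj)
        rw [event_comm, event_ge]
        refine mem_openConnGe_two_of_notMem h3 huz fun hm => hna ?_
        exact (SimpleGraph.mem_edgeSet _).1 (hF.lattice _ (hF.witness_subset _ 3 hm))
      · refine (junF_firstStar_xb_le₃' p M x b w t z a τ ha' _ _ _ _ _ _ _ _ _ _).trans ?_
        rw [hwu, hx]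
        exact piPerc_midS_zero_one_e_le_blockAiotaSt p hb (fun h => huz h.symm) _
    · -- sub-row `x ≠ e`: square
      refine nonempty_jPkg_firstStar_core p M x b w t z a τ c κ hb ha' X0 X1 X2
        (event (ge 1) (z (0 : Fin (M + 1)).castSucc) (b (0 : Fin (M + 1)).castSucc).1)
        (event (ge 1) (b (0 : Fin (M + 1)).castSucc).2 (t (0 : Fin (M + 1)).castSucc))
        (event (eq 1) (t (0 : Fin (M + 1)).castSucc) (z (0 : Fin (M + 1)).castSucc))
        (event (ge 1) (t (0 : Fin (M + 1)).castSucc) (b (0 : Fin (M + 1)).succ).1)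
        (event (ge 1) (b (0 : Fin (M + 1)).succ).1 (z (0 : Fin (M + 1)).castSucc)) f0 f1 f2
        (isFinitary_event _ _ _) (isFinitary_event _ _ _) (isFinitary_event _ _ _) (isFinitary_event _ _ _)
        (isFinitary_event _ _ _)
        (fun ω K₀ hF => ⟨(hmem₀ ω K₀ hF).1, (hmem₀ ω K₀ hF).2.1, (hmem₀ ω K₀ hF).2.2, ?_, ?_,
          hbond ω K₀ hF, (hexit ω K₀ hF).1, (hexit ω K₀ hF).2⟩)
        (hrow₀ _ rfl rfl rfl) ?_ (hrow₂ _ _ _ _ _ _ _ _)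
      · have h3 := firstSOpen_exit_mem M x b w t z a c τ hF huz hw0
        rwa [endX, if_pos rfl] at h3
      · obtain ⟨h0', -⟩ := hF.conn_closedU 0 ha'
        rw [event_ge]; exact mem_openConnGe_one_of_ne h0' (fun h => hx h.symm)
      · refine (junF_firstStar_xb_le₄ p M x b w t z a τ ha' _ _ _ _ _ _ _ _ _ _).trans ?_
        rw [hwu]
        exact piPerc_midS_zero_one_ne_le_blockAiotaSt p hb (fun h => huz h.symm) _
  · refine nonempty_jPkg_firstStar_core p M x b w t z a τ c κ hb ha' X0 X1 X2
      (endX a₀ (b (0 : Fin (M + 1)).castSucc).1 (w (0 : Fin (M + 1)).castSucc) (z (0 : Fin (M + 1)).castSucc))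
      (event (ge 0) (b (0 : Fin (M + 1)).castSucc).2 (t (0 : Fin (M + 1)).castSucc))
      (event (eq 1) (t (0 : Fin (M + 1)).castSucc) (z (0 : Fin (M + 1)).castSucc))
      (event (ge 1) (t (0 : Fin (M + 1)).castSucc) (b (0 : Fin (M + 1)).succ).1)
      (event (ge 1) (b (0 : Fin (M + 1)).succ).1 (z (0 : Fin (M + 1)).castSucc)) f0 f1 f2
      (isFinitary_endX _ _ _ _) (isFinitary_event _ _ _) (isFinitary_event _ _ _) (isFinitary_event _ _ _)
      (isFinitary_event _ _ _)
      (fun ω K₀ hF => ⟨(hmem₀ ω K₀ hF).1, (hmem₀ ω K₀ hF).2.1, (hmem₀ ω K₀ hF).2.2,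
        firstSOpen_exit_mem M x b w t z a c τ hF huz hw0, ?_, hbond ω K₀ hF, (hexit ω K₀ hF).1,
        (hexit ω K₀ hF).2⟩)
      (hrow₀ _ rfl rfl rfl) ?_ (hrow₂ _ _ _ _ _ _ _ _)
    · obtain ⟨h0', -⟩ := hF.conn_closedU 0 ha'
      rw [event_ge]; exact mem_openConnGe_zero_of_mem h0'
    · refine (junF_firstStar_xb_le₄ p M x b w t z a τ ha' _ _ _ _ _ _ _ _ _ _).trans ?_
      rw [endX, if_neg h0]
      obtain h1 | h2 : a₀ = 1 ∨ a₀ = 2 := by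
        fin_cases a₀
        · exact absurd rfl h0
        · exact Or.inl rfl
        · exact Or.inr rfl
      · subst h1
        obtain ⟨κ'', hκ''⟩ := (zdGraph_adj_iff_stepVec _ _).1 (hw1 rfl)
        exact piPerc_midS_one_one_le_blockAiotaSt p hb hκ'' _
      · subst h2
        exact piPerc_midS_two_one_le_blockAiotaSt p hb _

/-- **Cells `(a_0, 0, ★)` off the pin, `a_0 ∈ {0,1,2}`, variant `F‴`, of the FIRST junction, PRIMED entry letter**
(row `a_0 = 0`: the §6.1 triangle `T_{1̲,1,1}(e, t_0−u_0, 0)`): in the regime `t_0 ≠ u_1` a package with target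
`P^{S,a_0}(u_0,w_0) · (A'^{κ,a_0,0,*}(u_0,w_0,t_0,z_0) · A^{0,0}(t_0,z_0,u_1,u_1))` — the `c = 0` summand of the first
term of (5.4) in the closed section.  Inner class `0` identifies `z_0 = t_0`; the two lines `t_0 → u_1`, `z_0 → u_1`
of the closed level are the double connection `ℙ(t_0 ⇔ u_1)` (`t_0 ≠ u_1`).  (On the pin the summand vanishes and
the second term of (5.4) pays: `nonempty_jPkg_firstStar_pin`.)
[cite: FitznerVanDerHofstad2017, §6.1 (6.4), "Case a = 0 and b = 0", "Case a = 1", "Case a ≥ 2" (arXiv:1506.07977v2 pp. 58–59); §5.1 (5.1)–(5.4) (pp. 46–48); (4.58), (4.62), (4.64) (pp. 41–42); App. B (pp. 73–75)] -/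
theorem nonempty_jPkg_firstStar_zero' (κ : Fin d × Bool)
    (hb : (b (0 : Fin (M + 1)).castSucc).2 = (b (0 : Fin (M + 1)).castSucc).1 + stepVec κ) (hc0 : (τ 0).2 = 0)
    (a₀ : Fin 3) (ha : a (0 : Fin (M + 1)).castSucc = Sum.inl a₀) {u₀ : Unit}
    (ha' : a (0 : Fin (M + 1)).succ = Sum.inr u₀)
    (hty : t (0 : Fin (M + 1)).castSucc ≠ (b (0 : Fin (M + 1)).succ).1) :
    Nonempty (JPkg p (jctx M x b w t z a τ (0 : Fin (M + 1)).castSucc) (JFacts M x b w t z a c τ)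
      (blockPS (Letters.perc d p) a₀ (b (0 : Fin (M + 1)).castSucc).1 (w (0 : Fin (M + 1)).castSucc) *
        (blockAiotaSt' (Letters.perc d p) κ a₀ 0 (b (0 : Fin (M + 1)).castSucc).1 (w (0 : Fin (M + 1)).castSucc)
            (t (0 : Fin (M + 1)).castSucc) (z (0 : Fin (M + 1)).castSucc) *
          blockA (Letters.perc d p) 0 0 (t (0 : Fin (M + 1)).castSucc) (z (0 : Fin (M + 1)).castSucc)
            (b (0 : Fin (M + 1)).succ).1 (b (0 : Fin (M + 1)).succ).1))) := by
  -- degenerate parameters: the piece is empty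
  by_cases hP : z (0 : Fin (M + 1)).castSucc = t (0 : Fin (M + 1)).castSucc ∧
      (b (0 : Fin (M + 1)).castSucc).1 ≠ t (0 : Fin (M + 1)).castSucc ∧
      (b (0 : Fin (M + 1)).castSucc).1 ≠ z (0 : Fin (M + 1)).castSucc ∧
      (b (0 : Fin (M + 1)).castSucc).2 ≠ z (0 : Fin (M + 1)).castSucc ∧
      ((b (0 : Fin (M + 1)).castSucc).1 = 0 → w (0 : Fin (M + 1)).castSucc = 0) ∧
      (a₀ = 0 → w (0 : Fin (M + 1)).castSucc = (b (0 : Fin (M + 1)).castSucc).1) ∧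
      (a₀ = 1 → (zdGraph d).Adj (b (0 : Fin (M + 1)).castSucc).1 (w (0 : Fin (M + 1)).castSucc)) ∧
      (a₀ = 2 → (b (0 : Fin (M + 1)).castSucc).1 ≠ w (0 : Fin (M + 1)).castSucc)
  swap
  · refine ⟨JPkg.vacuous p _ _ (fun ω K₀ hF => hP ?_) _⟩
    obtain ⟨-, hut, huz, hvz, hcan, hw0, hw1, hw2, hc0', -, -, -⟩ := firstStar_facts M x b w t z a c τ hF ha ha'
    exact ⟨(hc0' hc0).symm, hut, huz, hvz, hcan, hw0, hw1, hw2⟩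
  obtain ⟨hzt, hut, huz, hvz, hcan, hw0, hw1, hw2⟩ := hP
  have hvt : (b (0 : Fin (M + 1)).castSucc).2 ≠ t (0 : Fin (M + 1)).castSucc := by rw [← hzt]; exact hvz
  obtain ⟨X0, X1, X2, f0, f1, f2, hmem₀, hrow₀⟩ :=
    first_startLetter_gl p M x b w t z a c τ glFirstS3 true false (.lo 0) rfl rfl rfl ha hcan hw0 hw1 hw2
  rw [hzt]
  have h := nonempty_jPkg_firstStar_core p M x b w t z a τ c κ hb ha' X0 X1 X2
    (endX a₀ (b (0 : Fin (M + 1)).castSucc).1 (w (0 : Fin (M + 1)).castSucc) (t (0 : Fin (M + 1)).castSucc))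
    (event (ge 1) (b (0 : Fin (M + 1)).castSucc).2 (t (0 : Fin (M + 1)).castSucc)) Set.univ
    (event (ge 0) (t (0 : Fin (M + 1)).castSucc) (b (0 : Fin (M + 1)).succ).1)
    (event (ge 0) (t (0 : Fin (M + 1)).castSucc) (b (0 : Fin (M + 1)).succ).1) f0 f1 f2
    (isFinitary_endX _ _ _ _) (isFinitary_event _ _ _) isFinitary_univ (isFinitary_event _ _ _)
    (isFinitary_event _ _ _) (fun ω K₀ hF => ?_) (hrow₀ _ rfl rfl rfl)
    (T₁ := blockAiotaSt' (Letters.perc d p) κ a₀ 0 (b (0 : Fin (M + 1)).castSucc).1 (w (0 : Fin (M + 1)).castSucc)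
      (t (0 : Fin (M + 1)).castSucc) (t (0 : Fin (M + 1)).castSucc))
    (T₂ := blockA (Letters.perc d p) 0 0 (t (0 : Fin (M + 1)).castSucc) (t (0 : Fin (M + 1)).castSucc)
      (b (0 : Fin (M + 1)).succ).1 (b (0 : Fin (M + 1)).succ).1) ?_ ?_
  · exact h
  · obtain ⟨h0, -, h2, h3⟩ := hF.conn_closedU 0 ha'
    rw [hzt] at h3
    have h5 := firstSOpen_exit_mem M x b w t z a c τ hF huz hw0
    rw [hzt] at h5
    refine ⟨(hmem₀ ω K₀ hF).1, (hmem₀ ω K₀ hF).2.1, (hmem₀ ω K₀ hF).2.2, h5, ?_, Set.mem_univ _, ?_, ?_⟩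
    · rw [event_ge]; exact mem_openConnGe_one_of_ne h0 hvt
    · rw [event_ge]; exact mem_openConnGe_zero_of_mem h2
    · rw [event_ge]; exact mem_openConnGe_zero_of_mem h3
  · -- `A'^{κ,a_0,0,*}`: bond, `b̄_0 → t_0` of length `≥ 1`, exit of level `0`
    refine (junF_firstStar_xb_le₃ p M x b w t z a τ ha' _ _ _ _ _ _ _ _ _ _).trans ?_
    unfold endX
    split_ifs with h0
    · subst h0
      rw [hw0 rfl]
      exact piPerc_midS_zero_zero_le_blockAiotaSt' p hb hvt.symm (fun h => hut h.symm) _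
    · obtain h1 | h2 : a₀ = 1 ∨ a₀ = 2 := by
        fin_cases a₀
        · exact absurd rfl h0
        · exact Or.inl rfl
        · exact Or.inr rfl
      · subst h1
        obtain ⟨κ', hκ'⟩ := (zdGraph_adj_iff_stepVec _ _).1 (hw1 rfl)
        rw [blockAiotaSt'_of_ne _ _ (fun h => absurd h.1 (by decide))]
        exact piPerc_midS_one_zero_le_blockAiotaSt p hb hκ' (fun h => hut h.symm) _
      · subst h2
        rw [blockAiotaSt'_of_ne _ _ (fun h => absurd h.1 (by decide))]
        exact piPerc_midS_two_zero_le_blockAiotaSt p hb _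
  · -- `A^{0,0}`: the double connection `t_0 ⇔ u_1` on the closed level `1`
    refine (junF_firstStar_up_le₂ p M x b w t z a τ ha' _ _ _ _ _ _ _ _ _ _).trans ?_
    exact piPerc_midS_zero_zero_le_blockA p hty _ rfl

/-- **Cells `(a_0, 0, ★)` off the pin, `a_0 ∈ {1,2}`, landed (App. B) entry letter**: target
`P^{S,a_0}(u_0,w_0) · (A^{κ,a_0,0,*}(u_0,w_0,t_0,z_0) · A^{0,0}(t_0,z_0,u_1,u_1))`, `t_0 ≠ u_1`.
[cite: FitznerVanDerHofstad2017, §6.1 (6.4), "Case a = 1 / a ≥ 2", "Case b = 0" (arXiv:1506.07977v2 pp. 58–59); §5.1 (5.1)–(5.4) (pp. 46–48); (4.58), (4.62) (p. 41); App. B (pp. 73–75)] -/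
theorem nonempty_jPkg_firstStar_zero (κ : Fin d × Bool)
    (hb : (b (0 : Fin (M + 1)).castSucc).2 = (b (0 : Fin (M + 1)).castSucc).1 + stepVec κ) (hc0 : (τ 0).2 = 0)
    (a₀ : Fin 3) (ha0 : a₀ ≠ 0) (ha : a (0 : Fin (M + 1)).castSucc = Sum.inl a₀) {u₀ : Unit}
    (ha' : a (0 : Fin (M + 1)).succ = Sum.inr u₀)
    (hty : t (0 : Fin (M + 1)).castSucc ≠ (b (0 : Fin (M + 1)).succ).1) :
    Nonempty (JPkg p (jctx M x b w t z a τ (0 : Fin (M + 1)).castSucc) (JFacts M x b w t z a c τ)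
      (blockPS (Letters.perc d p) a₀ (b (0 : Fin (M + 1)).castSucc).1 (w (0 : Fin (M + 1)).castSucc) *
        (blockAiotaSt (Letters.perc d p) κ a₀ 0 (b (0 : Fin (M + 1)).castSucc).1 (w (0 : Fin (M + 1)).castSucc)
            (t (0 : Fin (M + 1)).castSucc) (z (0 : Fin (M + 1)).castSucc) *
          blockA (Letters.perc d p) 0 0 (t (0 : Fin (M + 1)).castSucc) (z (0 : Fin (M + 1)).castSucc)
            (b (0 : Fin (M + 1)).succ).1 (b (0 : Fin (M + 1)).succ).1))) := by
  rw [← blockAiotaSt'_of_ne _ _ (fun h => ha0 h.1)]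
  exact nonempty_jPkg_firstStar_zero' p M x b w t z a c τ κ hb hc0 a₀ ha ha' hty

/-- **All off-pin ★-cells of the first junction, variant `F‴`, dispatched on the inner class `c = (τ 0).2`**, primed
entry letter (row `(a_0,c) = (0,0)` in the §6.1 reading; every other row = the landed App. B table): target
`P^{S,a_0}(u_0,w_0) · (A'^{κ,a_0,c,*}(u_0,w_0,t_0,z_0) · A^{c,0}(t_0,z_0,u_1,u_1))`, `t_0 ≠ u_1`.
[cite: FitznerVanDerHofstad2017, §6.1 (6.4) and the Cases a, b ∈ {0, 1, ≥ 2} (arXiv:1506.07977v2 pp. 58–59); §5.1 (5.1)–(5.4) (pp. 46–48); (4.58), (4.62) (p. 41); App. B (pp. 73–75)] -/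
theorem nonempty_jPkg_firstStar' (κ : Fin d × Bool)
    (hb : (b (0 : Fin (M + 1)).castSucc).2 = (b (0 : Fin (M + 1)).castSucc).1 + stepVec κ)
    (c₁ : Fin 3) (hc : (τ 0).2 = c₁) (a₀ : Fin 3) (ha : a (0 : Fin (M + 1)).castSucc = Sum.inl a₀) {u₀ : Unit}
    (ha' : a (0 : Fin (M + 1)).succ = Sum.inr u₀)
    (hty : t (0 : Fin (M + 1)).castSucc ≠ (b (0 : Fin (M + 1)).succ).1) :
    Nonempty (JPkg p (jctx M x b w t z a τ (0 : Fin (M + 1)).castSucc) (JFacts M x b w t z a c τ)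
      (blockPS (Letters.perc d p) a₀ (b (0 : Fin (M + 1)).castSucc).1 (w (0 : Fin (M + 1)).castSucc) *
        (blockAiotaSt' (Letters.perc d p) κ a₀ c₁ (b (0 : Fin (M + 1)).castSucc).1 (w (0 : Fin (M + 1)).castSucc)
            (t (0 : Fin (M + 1)).castSucc) (z (0 : Fin (M + 1)).castSucc) *
          blockA (Letters.perc d p) c₁ 0 (t (0 : Fin (M + 1)).castSucc) (z (0 : Fin (M + 1)).castSucc)
            (b (0 : Fin (M + 1)).succ).1 (b (0 : Fin (M + 1)).succ).1))) := by
  obtain h0 | h1 | h2 : c₁ = 0 ∨ c₁ = 1 ∨ c₁ = 2 := by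
    fin_cases c₁
    · exact Or.inl rfl
    · exact Or.inr (Or.inl rfl)
    · exact Or.inr (Or.inr rfl)
  · subst h0
    exact nonempty_jPkg_firstStar_zero' p M x b w t z a c τ κ hb hc a₀ ha ha' hty
  · subst h1
    rw [blockAiotaSt'_of_ne _ _ (fun h => absurd h.2 (by decide))]
    exact nonempty_jPkg_firstStar_one p M x b w t z a c τ κ hb hc a₀ ha ha'
  · subst h2
    rw [blockAiotaSt'_of_ne _ _ (fun h => absurd h.2 (by decide))]
    exact nonempty_jPkg_firstStar_two p M x b w t z a c τ κ hb hc a₀ ha ha'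

/-- **Cells `(a_0, 0, ★)` on the pin, `a_0 ∈ {0,1,2}`, variant `F‴`, of the FIRST junction**: in the regime
`t_0 = u_1` (then `z_0 = t_0`: the closed level `1` is the bare backbone piece `b̄_0 → u_1`) a package with target
`P^{S,a_0}(u_0,w_0) · A'^{κ,a_0,0}(u_0,w_0,u_1,t_0)` = the second term of (5.4) at its internal vertex (there
`δ_{z,t} = 1`, `P^0(0,0) = 1`, and the `c = 0` summand of the first term vanishes).  The single genuine non-start
letter is the triangle bond · `{b̄_0 ←1→ t_0}` · exit line of level `0` (`t_0 = z_0 ≠ b̄_0` by (4.64)); twin of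
`NobleBoundsNFirstF1.nonempty_jPkg_firstF1_zero'` over the closed-level readings.
[cite: FitznerVanDerHofstad2017, §6.1 (6.4), "Case a = 0 and b = 0", "Case a = 1", "Case a ≥ 2" (arXiv:1506.07977v2 pp. 58–59); §5.1 (5.4) second term (p. 48); (4.58), (4.62), (4.64) (pp. 41–42); App. B (pp. 73, 75)] -/
theorem nonempty_jPkg_firstStar_pin (κ : Fin d × Bool)
    (hb : (b (0 : Fin (M + 1)).castSucc).2 = (b (0 : Fin (M + 1)).castSucc).1 + stepVec κ) (hc0 : (τ 0).2 = 0)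
    (a₀ : Fin 3) (ha : a (0 : Fin (M + 1)).castSucc = Sum.inl a₀) {u₀ : Unit}
    (ha' : a (0 : Fin (M + 1)).succ = Sum.inr u₀)
    (hty : t (0 : Fin (M + 1)).castSucc = (b (0 : Fin (M + 1)).succ).1) :
    Nonempty (JPkg p (jctx M x b w t z a τ (0 : Fin (M + 1)).castSucc) (JFacts M x b w t z a c τ)
      (blockPS (Letters.perc d p) a₀ (b (0 : Fin (M + 1)).castSucc).1 (w (0 : Fin (M + 1)).castSucc) *
        blockAiota' (Letters.perc d p) κ a₀ 0 (b (0 : Fin (M + 1)).castSucc).1 (w (0 : Fin (M + 1)).castSucc)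
          (b (0 : Fin (M + 1)).succ).1 (t (0 : Fin (M + 1)).castSucc))) := by
  -- degenerate parameters: the piece is empty
  by_cases hP : z (0 : Fin (M + 1)).castSucc = t (0 : Fin (M + 1)).castSucc ∧
      (b (0 : Fin (M + 1)).castSucc).1 ≠ t (0 : Fin (M + 1)).castSucc ∧
      (b (0 : Fin (M + 1)).castSucc).2 ≠ t (0 : Fin (M + 1)).castSucc ∧
      (b (0 : Fin (M + 1)).castSucc).1 ≠ z (0 : Fin (M + 1)).castSucc ∧
      ((b (0 : Fin (M + 1)).castSucc).1 = 0 → w (0 : Fin (M + 1)).castSucc = 0) ∧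
      (a₀ = 0 → w (0 : Fin (M + 1)).castSucc = (b (0 : Fin (M + 1)).castSucc).1) ∧
      (a₀ = 1 → (zdGraph d).Adj (b (0 : Fin (M + 1)).castSucc).1 (w (0 : Fin (M + 1)).castSucc)) ∧
      (a₀ = 2 → (b (0 : Fin (M + 1)).castSucc).1 ≠ w (0 : Fin (M + 1)).castSucc)
  swap
  · refine ⟨JPkg.vacuous p _ _ (fun ω K₀ hF => hP ?_) _⟩
    obtain ⟨-, hut, huz, hvz, hcan, hw0, hw1, hw2, hc0', -, -, -⟩ := firstStar_facts M x b w t z a c τ hF ha ha'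
    have hzt := (hc0' hc0).symm
    exact ⟨hzt, hut, by rw [← hzt]; exact hvz, huz, hcan, hw0, hw1, hw2⟩
  obtain ⟨hzt, hut, hvt, huz, hcan, hw0, hw1, hw2⟩ := hP
  obtain ⟨X0, X1, X2, f0, f1, f2, hmem₀, hrow₀⟩ :=
    first_startLetter_gl p M x b w t z a c τ glFirstS3 true false (.lo 0) rfl rfl rfl ha hcan hw0 hw1 hw2
  rw [← hty]
  have h := nonempty_jPkg_firstStar_core₂ p M x b w t z a τ c κ hb ha' X0 X1 X2
    (endX a₀ (b (0 : Fin (M + 1)).castSucc).1 (w (0 : Fin (M + 1)).castSucc) (t (0 : Fin (M + 1)).castSucc))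
    (event (ge 1) (b (0 : Fin (M + 1)).castSucc).2 (t (0 : Fin (M + 1)).castSucc)) f0 f1 f2
    (isFinitary_endX _ _ _ _) (isFinitary_event _ _ _) (fun ω K₀ hF => ?_) (hrow₀ _ rfl rfl rfl)
    (T₁ := blockAiota' (Letters.perc d p) κ a₀ 0 (b (0 : Fin (M + 1)).castSucc).1 (w (0 : Fin (M + 1)).castSucc)
      (t (0 : Fin (M + 1)).castSucc) (t (0 : Fin (M + 1)).castSucc)) ?_
  · exact h
  · obtain ⟨h0, -⟩ := hF.conn_closedU 0 ha'
    have h3 := firstSOpen_exit_mem M x b w t z a c τ hF huz hw0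
    rw [hzt] at h3
    refine ⟨(hmem₀ ω K₀ hF).1, (hmem₀ ω K₀ hF).2.1, (hmem₀ ω K₀ hF).2.2, h3, ?_⟩
    rw [event_ge]; exact mem_openConnGe_one_of_ne h0 hvt
  · -- the letter: bond, `b̄_0 → t_0` of length `≥ 1`, exit of level `0`
    refine (junF_firstStar_xb_le₃ p M x b w t z a τ ha' _ _ _ _ _ _ _ _ _ _).trans ?_
    unfold endX
    split_ifs with h0
    · subst h0
      rw [hw0 rfl]
      exact piPerc_midF1_zero_zero_le_blockAiota' p hb hvt.symm (fun h => hut h.symm) _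
    · obtain h1 | h2 : a₀ = 1 ∨ a₀ = 2 := by
        fin_cases a₀
        · exact absurd rfl h0
        · exact Or.inl rfl
        · exact Or.inr rfl
      · subst h1
        obtain ⟨κ', hκ'⟩ := (zdGraph_adj_iff_stepVec _ _).1 (hw1 rfl)
        rw [blockAiota'_of_ne _ _ (by decide)]
        exact piPerc_midF1_one_zero_le_blockAiota p hb hκ' (fun h => hut h.symm) _
      · subst h2
        rw [blockAiota'_of_ne _ _ (by decide)]
        exact piPerc_midF1_two_zero_le_blockAiota p hb _

end Packages

end Literature.Probability.FitznerVanDerHofstad2017
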